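import Mathlib.MeasureTheory.OuterMeasure.BorelCantelli
import Mathlib.Analysis.SpecificLimits.Normed
import Literature.Probability.RandomPlanarGeometry.SLEDerivativeEstimates
import HarnessLib

/-!
# Derivative bounds for `f̂ₜ` on the dyadic grid, almost surely (Rohde–Schramm Thm. 3.6, step 1)

Trunk T-STOCH. The Borel–Cantelli step of the proof of Rohde–Schramm's Theorem 3.6
(*Basic properties of SLE*, Ann. Math. 161 (2005), pp. 895–897; in the architecture of Lawler,
*Conformally Invariant Processes in the Plane* (2005), proof of Thm. 7.4, p. 188–189: "it
suffices by Lemma 7.6 and the Borel–Cantelli Lemma to find `c, ε` such that for all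
`0 ≤ t ≤ 1`, `P{|h'ₜ(i2^{-j})| ≥ 2^{j-ε}} ≤ c 2^{-(2+ε)j}`").

Input: the named fact `Literature.Probability.RandomPlanarGeometry.RohdeSchramm2005_cor35` (Rohde–Schramm Cor. 3.5, vendored in
`SLEDerivativeEstimates.lean`) through its proved consequence
`Literature.Probability.RandomPlanarGeometry.RohdeSchramm2005_cor35.gridBound`: for `κ > 0`, `κ ≠ 8`, `0 < σ < σ₀(κ)` there are `ε > 0`
and `C` with `P[|f̂ₜ'(i 2^{-j})| ≥ 2^{(1-σ)j}] ≤ C (j+1) 2^{-(2+ε)j}` for all `t ≤ 1`, `j ∈ ℕ`.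

Output (this file, proved):

* `Literature.Probability.RandomPlanarGeometry.RohdeSchramm2005_cor35.ae_eventually_grid` — summing over the `4ʲ` grid times
  `t = k 4^{-j} ∈ [0, 1)` gives bad events of probability `≤ C (j+1) 2^{-εj}`, a summable
  series, so almost surely, for all sufficiently large `j` and all `k < 4ʲ`,
  `|f̂'_{k 4^{-j}}(i 2^{-j})| < 2^{(1-σ) j}`;
* `Literature.Probability.RandomPlanarGeometry.RohdeSchramm2005_cor35.ae_exists_grid` — hence almost surely there is a (random) `c` with
  `|f̂'_{k 4^{-j}}(i 2^{-j})| ≤ c 2^{(1-σ) j} = 2ʲ · (c 2^{-σ j})` for *all* `j` and `k < 4ʲ`,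
  which is hypothesis (4.27) of Lawler's Lemma 4.33 with `r_j = c 2^{-σj}`.

Both are stated, like the fact, for an arbitrary Brownian motion `B` with everywhere-continuous
paths on a probability space `(Ω, P)` and the driving function `√κ B`; the time range `t ≤ 1`
is what Cor. 3.5 provides (larger ranges follow by Brownian scaling, `IsBrownianReal.smul`).
No measurability is needed (outer measures, `MeasureTheory.ae_eventually_notMem`).

## References

* S. Rohde, O. Schramm, *Basic properties of SLE*, Ann. of Math. 161 (2005), Cor. 3.5, proof of
  Thm. 3.6 (eq. (3.19)–(3.20)).
* G. F. Lawler, *Conformally Invariant Processes in the Plane*, AMS (2005), Lemma 4.33 (4.27),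
  proof of Thm. 7.4 (7.12).
-/

noncomputable section

open Set Filter Topology Complex MeasureTheory ProbabilityTheory
open scoped NNReal ENNReal

namespace Literature.Probability.RandomPlanarGeometry

variable {Ω : Type*} [MeasurableSpace Ω] {P : Measure Ω}

/-- Exponent bookkeeping: `4ʲ · 2^{-(2+ε) j} = 2^{-ε j}`. [folklore] -/
theorem four_pow_mul_two_rpow (ε : ℝ) (j : ℕ) :
    (4 : ℝ) ^ j * (2 : ℝ) ^ (-(2 + ε) * j) = (2 : ℝ) ^ (-(ε * j)) := by
  have h4 : (4 : ℝ) ^ j = (2 : ℝ) ^ ((2 * j : ℕ) : ℝ) := by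
    rw [Real.rpow_natCast, pow_mul]
    norm_num
  rw [h4, ← Real.rpow_add two_pos]
  congr 1
  push_cast
  ring

/-- The series `∑ⱼ (j + 1) 2^{-εj}` converges for `ε > 0`. [folklore] -/
theorem summable_succ_mul_two_rpow_neg {ε : ℝ} (hε : 0 < ε) :
    Summable (fun j : ℕ ↦ ((j : ℝ) + 1) * (2 : ℝ) ^ (-(ε * j))) := by
  set r : ℝ := (2 : ℝ) ^ (-ε) with hr
  have hr0 : 0 ≤ r := Real.rpow_nonneg two_pos.le _
  have hr1 : r < 1 := Real.rpow_lt_one_of_one_lt_of_neg one_lt_two (by linarith)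
  have hnorm : ‖r‖ < 1 := by rwa [Real.norm_of_nonneg hr0]
  have h1 : Summable (fun j : ℕ ↦ (j : ℝ) * r ^ j) := by
    simpa using summable_pow_mul_geometric_of_norm_lt_one 1 hnorm
  have h2 : Summable (fun j : ℕ ↦ r ^ j) := summable_geometric_of_lt_one hr0 hr1
  have heq : (fun j : ℕ ↦ ((j : ℝ) + 1) * (2 : ℝ) ^ (-(ε * j))) =
      fun j : ℕ ↦ (j : ℝ) * r ^ j + r ^ j := by
    funext j
    have : (2 : ℝ) ^ (-(ε * j)) = r ^ j := by
      rw [hr, ← Real.rpow_natCast, ← Real.rpow_mul two_pos.le]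
      congr 1
      ring
    rw [this]
    ring
  rw [heq]
  exact h1.add h2

/-- **Derivative bounds on the grid, eventually** (Borel–Cantelli on
`RohdeSchramm2005_cor35.gridBound`): for `κ > 0`, `κ ≠ 8`, `0 < σ < σ₀(κ)` and a Brownian motion
`B` with continuous paths, almost surely, for all sufficiently large `j` and every `k < 4ʲ`,
`|f̂'_{k 4^{-j}}(i 2^{-j})| < 2^{(1-σ) j}` for the driving function `√κ B`. Rohde–Schramm (2005),
proof of Thm. 3.6 ("there are at most finitely many pairs `j, k`…", p. 897); Lawler (2005), proof
of Thm. 7.4. [cite: RohdeSchramm2005, Thm 3.6 (proof)] -/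
theorem RohdeSchramm2005_cor35.ae_eventually_grid (h : RohdeSchramm2005_cor35 P) {κ : ℝ≥0}
    (hκ : κ ≠ 0) (h8 : κ ≠ 8) {σ : ℝ} (hσ0 : 0 < σ) (hσ : σ < RohdeSchramm.sigma0 κ)
    {B : ℝ≥0 → Ω → ℝ} (hB : IsBrownianReal B P) (hBc : ∀ ω, Continuous (B · ω)) :
    ∀ᵐ ω ∂P, ∀ᶠ j : ℕ in atTop, ∀ k : ℕ, k < 4 ^ j →
      ‖deriv (Loewner.fHat (fun s ↦ Real.sqrt κ * B s ω) ((k : ℝ≥0) / 4 ^ j))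
        (I * ((2 : ℝ) ^ (-(j : ℝ)) : ℝ))‖ < (2 : ℝ) ^ ((1 - σ) * j) := by
  obtain ⟨ε, hε, C, hC⟩ := h.gridBound κ hκ h8 σ hσ0 hσ
  -- the derivative at the grid point `(k 4^{-j}, i 2^{-j})`
  set D : Ω → ℕ → ℕ → ℝ := fun ω j k ↦
    ‖deriv (Loewner.fHat (fun s ↦ Real.sqrt κ * B s ω) ((k : ℝ≥0) / 4 ^ j))
      (I * ((2 : ℝ) ^ (-(j : ℝ)) : ℝ))‖ with hD
  -- bad events
  set A : ℕ → Set Ω := fun j ↦ ⋃ k ∈ Finset.range (4 ^ j),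
    {ω | (2 : ℝ) ^ ((1 - σ) * j) ≤ D ω j k} with hA
  set C' : ℝ := max C 0 with hC'
  have hC'0 : 0 ≤ C' := le_max_right _ _
  have hone : ∀ j k : ℕ, k < 4 ^ j →
      P {ω | (2 : ℝ) ^ ((1 - σ) * j) ≤ D ω j k} ≤
        ENNReal.ofReal (C' * (j + 1) * (2 : ℝ) ^ (-(2 + ε) * j)) := by
    intro j k hk
    have ht : ((k : ℝ≥0) / 4 ^ j) ≤ 1 := by
      rw [div_le_iff₀ (by positivity), one_mul]
      exact_mod_cast hk.le
    refine (hC B hB hBc _ ht j).trans (ENNReal.ofReal_le_ofReal ?_)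
    have : 0 ≤ ((j : ℝ) + 1) * (2 : ℝ) ^ (-(2 + ε) * j) :=
      mul_nonneg (by positivity) (Real.rpow_nonneg two_pos.le _)
    nlinarith [le_max_left C 0]
  have hbound : ∀ j, P (A j) ≤ ENNReal.ofReal (C' * (((j : ℝ) + 1) * (2 : ℝ) ^ (-(ε * j)))) := by
    intro j
    calc P (A j) ≤ ∑ k ∈ Finset.range (4 ^ j), P {ω | (2 : ℝ) ^ ((1 - σ) * j) ≤ D ω j k} :=
          measure_biUnion_finset_le _ _
      _ ≤ ∑ _k ∈ Finset.range (4 ^ j), ENNReal.ofReal (C' * (j + 1) * (2 : ℝ) ^ (-(2 + ε) * j)) :=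
          Finset.sum_le_sum fun k hk ↦ hone j k (Finset.mem_range.1 hk)
      _ = ENNReal.ofReal ((4 ^ j : ℕ) : ℝ) *
            ENNReal.ofReal (C' * (j + 1) * (2 : ℝ) ^ (-(2 + ε) * j)) := by
          rw [Finset.sum_const, Finset.card_range, nsmul_eq_mul, ENNReal.ofReal_natCast]
      _ = ENNReal.ofReal (((4 ^ j : ℕ) : ℝ) * (C' * (j + 1) * (2 : ℝ) ^ (-(2 + ε) * j))) :=
          (ENNReal.ofReal_mul (by positivity)).symm
      _ = ENNReal.ofReal (C' * (((j : ℝ) + 1) * (2 : ℝ) ^ (-(ε * j)))) := by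
          rw [← four_pow_mul_two_rpow ε j]
          push_cast
          ring_nf
  have hsum : ∑' j, P (A j) ≠ ∞ := by
    refine ne_top_of_le_ne_top ?_ (ENNReal.tsum_le_tsum hbound)
    have hnn : ∀ j : ℕ, 0 ≤ C' * (((j : ℝ) + 1) * (2 : ℝ) ^ (-(ε * j))) :=
      fun j ↦ mul_nonneg hC'0 (mul_nonneg (by positivity) (Real.rpow_nonneg two_pos.le _))
    rw [← ENNReal.ofReal_tsum_of_nonneg hnn ((summable_succ_mul_two_rpow_neg hε).mul_left C')]
    exact ENNReal.ofReal_ne_top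
  filter_upwards [ae_eventually_notMem hsum] with ω hω
  filter_upwards [hω] with j hj k hk
  simp only [hA, Set.mem_iUnion, Finset.mem_range, Set.mem_setOf_eq, not_exists, not_le,
    exists_prop, not_and] at hj
  exact hj k hk

/-- **Derivative bounds on the grid with a random constant** (hypothesis (4.27) of Lawler's
Lemma 4.33 with `r_j = c 2^{-σj}`): under the same hypotheses, almost surely there is `c` with
`|f̂'_{k 4^{-j}}(i 2^{-j})| ≤ c 2^{(1-σ) j}` for all `j` and all `k < 4ʲ`.
[cite: Lawler2005, Lemma 4.33 (4.27)] -/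
theorem RohdeSchramm2005_cor35.ae_exists_grid (h : RohdeSchramm2005_cor35 P) {κ : ℝ≥0}
    (hκ : κ ≠ 0) (h8 : κ ≠ 8) {σ : ℝ} (hσ0 : 0 < σ) (hσ : σ < RohdeSchramm.sigma0 κ)
    {B : ℝ≥0 → Ω → ℝ} (hB : IsBrownianReal B P) (hBc : ∀ ω, Continuous (B · ω)) :
    ∀ᵐ ω ∂P, ∃ c : ℝ, ∀ j k : ℕ, k < 4 ^ j →
      ‖deriv (Loewner.fHat (fun s ↦ Real.sqrt κ * B s ω) ((k : ℝ≥0) / 4 ^ j))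
        (I * ((2 : ℝ) ^ (-(j : ℝ)) : ℝ))‖ ≤ c * (2 : ℝ) ^ ((1 - σ) * j) := by
  have hσ1 : σ < 1 :=
    hσ.trans (RohdeSchramm.sigma0_lt_one (by exact_mod_cast pos_iff_ne_zero.2 hκ))
  filter_upwards [h.ae_eventually_grid hκ h8 hσ0 hσ hB hBc] with ω hω
  obtain ⟨j₀, hj₀⟩ := eventually_atTop.1 hω
  -- the grid values, as an opaque function `D j k`
  obtain ⟨D, hD⟩ : ∃ D : ℕ → ℕ → ℝ, ∀ j k : ℕ, D j k =
      ‖deriv (Loewner.fHat (fun s ↦ Real.sqrt κ * B s ω) ((k : ℝ≥0) / 4 ^ j))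
        (I * ((2 : ℝ) ^ (-(j : ℝ)) : ℝ))‖ := ⟨_, fun _ _ ↦ rfl⟩
  have hD0 : ∀ j k, 0 ≤ D j k := fun j k ↦ by rw [hD]; exact norm_nonneg _
  -- a bound for the finitely many grid values with `j < j₀`
  set S : Finset (Σ _ : ℕ, ℕ) := (Finset.range j₀).sigma fun j ↦ Finset.range (4 ^ j) with hS
  obtain ⟨M, hM0, hMle⟩ : ∃ M : ℝ, 0 ≤ M ∧ ∀ j k : ℕ, j < j₀ → k < 4 ^ j → D j k ≤ M := by
    refine ⟨∑ p ∈ S, D p.1 p.2, Finset.sum_nonneg fun p _ ↦ hD0 _ _, fun j k hj hk ↦ ?_⟩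
    have hp : (⟨j, k⟩ : Σ _ : ℕ, ℕ) ∈ S := by
      rw [hS, Finset.mem_sigma]
      exact ⟨Finset.mem_range.2 hj, Finset.mem_range.2 hk⟩
    exact Finset.single_le_sum (f := fun p : (Σ _ : ℕ, ℕ) ↦ D p.1 p.2) (fun p _ ↦ hD0 _ _) hp
  have hpow : ∀ j : ℕ, 1 ≤ (2 : ℝ) ^ ((1 - σ) * j) := fun j ↦
    Real.one_le_rpow one_le_two (mul_nonneg (by linarith) (Nat.cast_nonneg j))
  refine ⟨max 1 M, fun j k hk ↦ ?_⟩
  rw [← hD]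
  rcases lt_or_ge j j₀ with hj | hj
  · calc D j k ≤ M := hMle j k hj hk
      _ ≤ max 1 M * 1 := by rw [mul_one]; exact le_max_right _ _
      _ ≤ max 1 M * (2 : ℝ) ^ ((1 - σ) * j) :=
          mul_le_mul_of_nonneg_left (hpow j) (le_trans zero_le_one (le_max_left _ _))
  · have hjk := hj₀ j hj k hk
    rw [← hD] at hjk
    calc D j k ≤ (2 : ℝ) ^ ((1 - σ) * j) := hjk.le
      _ = 1 * (2 : ℝ) ^ ((1 - σ) * j) := (one_mul _).symm
      _ ≤ max 1 M * (2 : ℝ) ^ ((1 - σ) * j) :=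
          mul_le_mul_of_nonneg_right (le_max_left _ _) (Real.rpow_nonneg two_pos.le _)

end Literature.Probability.RandomPlanarGeometry
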